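import Summits.CriticalPhenomena.PercolationContinuityZ3.Theorems.Transplant.SkelNegBParamsFaceBandA
import HarnessLib

/-!
# N1 params, (ζ′) chain, part FaceBandA2: THE CONTACT BAND ROOM AT THE FACE-APRON REACH `Rl ≤ 2·RA′` (hp-8 g36's located (iii), lane INBOX
# 2026-08-22T07:57:42Z (3): the provider layer reads `kE := (prFA).kFF₂ fcellsA (E − 1) du.1` with `E := RlevA + reachA`, i.e. `Rl = RlevA + reachA − 1 = RA′ − 2 + reachA`,
# which EXCEEDS `RA′` — part FaceBandA's `hkE_RA` (`Rl ≤ RA′`) does not apply; here the same two rooms, with the constants G-Y/G-Z consume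
# (`kFF₂ + 8·u + 9 ≤ 5·r`, `2·kFF₂ + 8·u + 8 ≤ 5·r`), for EVERY `Rl ≤ 2·RA′` (`kFF₂ ≤ 2r + 5Rl + 15`, `u ≥ 6RA′ + 11`, `r = 40·Kq·u`) and at `Rl := RlevA + reachA − 1`
# by name (p1-g14, 2026-08-22).
builds on p205010 (kernel theorem, internal audit signed; external expert review pending) — nothing in this file uses p205010; NOTHING is claimed about
the node `SamePDropOfSkeletonNeg₁` (OPEN).
Lane `prim-bschramm-*`, seat `prim-bschramm-p1` (gen 14); helper file (`--supports stmt-CriticalPhenomena-4575 --as helper`); slot-ledger ζ′ v1.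
* **`hkE_RA2`** (`Rl ≤ 2·RA′`), `apronRl_le` (`RlevA + reachA − 1 ≤ 2·RA′`), **`hkE_apron_RA`** (at `Rl := RlevA mk + reachA mk − 1`).
[cite: KozmaNitzan2024, §4 Lemma 10 Step IV (pp. 20–21); Lemma 12 (pp. 23–25)] [cite: MartineauTassion2017, §4.3]
-/

noncomputable section

open scoped Classical

namespace Summit.CriticalPhenomena.PercolationContinuityZ3.Theorems.Transplant

namespace PlanarSkeletonNeg

namespace NegB

open Literature.Probability.Percolation Literature.Probability.LatticeModels SimpleGraph
open Literature.Probability.Percolation.KozmaNitzan.Cells (oth)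
open SkelConc (Consts)
open Skelφ.StepI (DataN)
open Neg

section Band2

variable (κ : Consts) {V : Type} [DecidableEq V] [Countable V] {G : SimpleGraph V} [G.LocallyFinite] (Φ : PlanarSkeletonNeg G) (t : V)
  (p : unitInterval) (D : DataN V) (f mk : ℕ) (gx : Neg.FSlot)

/-- **THE CONTACT BAND ROOMS AT `Rl ≤ 2·RA′`** (`g := gT`, both axes, `u_JA = s_J`): `kFF₂ + 8·u_JA + 9 ≤ 5·r_J` and `2·kFF₂ + 8·u_JA + 8 ≤ 5·r_J`
(from `kFF₂ ≤ 2r + 5Rl + 15`, `10·RA′ < 2·u_JA`, `40·u_JA ≤ r_J`). [cite: KozmaNitzan2024, §4 Lemma 12 (pp. 23–25)] -/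
theorem hkE_RA2 (hN : EqNumL κ Φ t p D (KS.gT mk gx κ Φ t p D) f) (hκ : (hL κ Φ t p D (KS.gT mk gx κ Φ t p D) f).natAbs ≤ 10 * nL κ Φ t p D (KS.gT mk gx κ Φ t p D) f)
    {Rl : ℕ} (hRl : Rl ≤ 2 * KS.RA' κ Φ t p D mk) (I : Fin 2) :
    (prFA κ Φ t p D (KS.gT mk gx κ Φ t p D) f).kFF₂ (fcellsA κ Φ t p D (KS.gT mk gx κ Φ t p D) f) Rl I +
          8 * (if oth I = 0 then KS.u₀A κ Φ t p D (KS.gT mk gx κ Φ t p D) f else KS.u₁A κ Φ t p D (KS.gT mk gx κ Φ t p D) f) + 9 ≤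
        5 * ((fcellsA κ Φ t p D (KS.gT mk gx κ Φ t p D) f).r (oth I) : ℤ) ∧
      2 * (prFA κ Φ t p D (KS.gT mk gx κ Φ t p D) f).kFF₂ (fcellsA κ Φ t p D (KS.gT mk gx κ Φ t p D) f) Rl I +
          8 * (if oth I = 0 then KS.u₀A κ Φ t p D (KS.gT mk gx κ Φ t p D) f else KS.u₁A κ Φ t p D (KS.gT mk gx κ Φ t p D) f) + 8 ≤
        5 * ((fcellsA κ Φ t p D (KS.gT mk gx κ Φ t p D) f).r (oth I) : ℤ) := by
  have hq := kFF₂_le_linA κ Φ t p D f mk gx hN hκ Rl I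
  obtain ⟨-, hu, hru⟩ := uA_oth_facts κ Φ t p D f mk gx hN hκ I
  have hRl' : (Rl : ℤ) ≤ 2 * KS.RA' κ Φ t p D mk := by exact_mod_cast hRl
  have hR0 : (0 : ℤ) ≤ (Rl : ℤ) := Nat.cast_nonneg _
  set q := (prFA κ Φ t p D (KS.gT mk gx κ Φ t p D) f).kFF₂ (fcellsA κ Φ t p D (KS.gT mk gx κ Φ t p D) f) Rl I
  set u := (if oth I = 0 then KS.u₀A κ Φ t p D (KS.gT mk gx κ Φ t p D) f else KS.u₁A κ Φ t p D (KS.gT mk gx κ Φ t p D) f)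
  set r := ((fcellsA κ Φ t p D (KS.gT mk gx κ Φ t p D) f).r (oth I) : ℤ)
  constructor <;> linarith

omit [DecidableEq V] in
/-- **The face-apron reach is at most `2·RA′`**: `RlevA + reachA − 1 ≤ 2·RA′` (`RA′ = RlevA + 1`, `RlevA = j₁A + reachA ≥ reachA`). [folklore] -/
theorem apronRl_le : KS.RlevA κ Φ t p D mk + KS.reachA t D mk - 1 ≤ 2 * KS.RA' κ Φ t p D mk := by
  have h := KS.RA'_eq κ Φ t p D mk
  unfold KS.RlevA at h ⊢
  omega

/-- **THE CONTACT BAND ROOMS AT THE PROVIDER'S `kE`** (`Rl := RlevA + reachA − 1`, hp-8 g36's `kE := kFF₂ … (E − 1) du.1`, `E := RlevA + reachA`):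
`kFF₂ + 8·u_JA + 9 ≤ 5·r_J` and `2·kFF₂ + 8·u_JA + 8 ≤ 5·r_J`. [cite: KozmaNitzan2024, §4 Lemma 12 (pp. 23–25)] -/
theorem hkE_apron_RA (hN : EqNumL κ Φ t p D (KS.gT mk gx κ Φ t p D) f) (hκ : (hL κ Φ t p D (KS.gT mk gx κ Φ t p D) f).natAbs ≤ 10 * nL κ Φ t p D (KS.gT mk gx κ Φ t p D) f)
    (I : Fin 2) :
    (prFA κ Φ t p D (KS.gT mk gx κ Φ t p D) f).kFF₂ (fcellsA κ Φ t p D (KS.gT mk gx κ Φ t p D) f) (KS.RlevA κ Φ t p D mk + KS.reachA t D mk - 1) I +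
          8 * (if oth I = 0 then KS.u₀A κ Φ t p D (KS.gT mk gx κ Φ t p D) f else KS.u₁A κ Φ t p D (KS.gT mk gx κ Φ t p D) f) + 9 ≤
        5 * ((fcellsA κ Φ t p D (KS.gT mk gx κ Φ t p D) f).r (oth I) : ℤ) ∧
      2 * (prFA κ Φ t p D (KS.gT mk gx κ Φ t p D) f).kFF₂ (fcellsA κ Φ t p D (KS.gT mk gx κ Φ t p D) f) (KS.RlevA κ Φ t p D mk + KS.reachA t D mk - 1) I +
          8 * (if oth I = 0 then KS.u₀A κ Φ t p D (KS.gT mk gx κ Φ t p D) f else KS.u₁A κ Φ t p D (KS.gT mk gx κ Φ t p D) f) + 8 ≤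
        5 * ((fcellsA κ Φ t p D (KS.gT mk gx κ Φ t p D) f).r (oth I) : ℤ) :=
  hkE_RA2 κ Φ t p D f mk gx hN hκ (apronRl_le κ Φ t p D mk) I

end Band2

end NegB

end PlanarSkeletonNeg

end Summit.CriticalPhenomena.PercolationContinuityZ3.Theorems.Transplant

end
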